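import Literature.NumberTheory.Automorphic.UnitaryGroupSiegelRootNormDecay
import Literature.NumberTheory.Automorphic.UnitaryGroupBorelSiegelSetStructureTwo
import Literature.NumberTheory.Automorphic.UnitaryGroupTorusRayTwo
import HarnessLib

/-!
# GLUE (ρ) at `N = 2`: on the Siegel set of `U(J₂)` the archimedean norm of the root value decays like `H^{-2/[E:ℚ]}`, and the torus
# factor of the thin set lies in «compact · ray»
(Rogawski, *Automorphic Representations of Unitary Groups in Three Variables* (1990), §2.2 p. 13; Borel, *Introduction aux groupes
arithmétiques* (1969), §12.3: on a Siegel set the simple roots are bounded below on `A_t`; Arthur (1978), §8.)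

Topic `NumberTheory/Automorphic`; namespace `Literature.NumberTheory.Automorphic.UnitaryGroup`.  THEOREMS ONLY (no definition, no
named fact, no instance, no notation, no `sorry`).  The `N = 2` sibling of ★ `UnitaryGroupSiegelRootNormDecay` (GLUE (ρ) of the
T1-qs sub-line): ONE root value `d₀⁻¹ d₁ = d₀⁻¹ (c d₀)⁻¹`, whose BALANCE on the torus Siegel set is `≤ κ · H^{−2/[E:ℚ]}` (★ H-B4
`exists_torusSiegelSet_two`), read on the Borel Siegel set `S = Ω · S_T · (B ∩ K_U)` (★ (R2) `rootValue_two_mul`, compactness of `B ∩ K_U`);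
and the torus factor `S_T · K_T` of the thin set in the «compact · ray» letters of ★ `setLIntegral_rpow_neg_borelHeight_lt_top` (any `N`)
through ★ H-B4 `exists_torusRay_two` ∕ `isCompact_setOf_diagUnit_zero_mem_two`.  H-side copy of LAWS 1–5 of the T1 engine
`Cruxes/H413/Lines/F0_T1InnerFormTraceIdentity.lean` (cell `pub/hodgecm-mathlib`, crux H413; census `CENSUS-LAWS-Hside.F0P3a-p03g6.md` §3 LAW 1
«`SiegelRootNormDecay` (287 → 150: one root)»; B-p14 (g26) NEXT-3 #2 (R4)).  HC_CM is proved only modulo the printed citations until rung 0 closes.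

* §1 **`exists_rootNorm_le_rpow_of_balance_two`** — on `S` above height `1`: `‖(d₀⁻¹ d₁)_∞‖ ≤ κ' · H(b)^{−2/[E:ℚ]}`;
  `exists_rootNorm_le_rpow_inv_of_balance_two` — the weaker `≤ κ' · H(b)^{−1/[E:ℚ]}` in the exponent of the `N = 3` letters.
* §2 **`exists_ray_compact_of_export_two`** — the torus factor `{t ∈ T(𝔸_F) | ↑t ∈ S_T · K_T}` of the thin set lies in `range ρ · 𝔎` with the
  ray `ρ` and a compact `𝔎` (the `(h𝔎, hρc, hρ, hH, hS)` inputs of ★ `setLIntegral_rpow_neg_borelHeight_lt_top` at `N = 2`, `κ = [E:ℚ]`).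

## References
* J. D. Rogawski, *Automorphic Representations of Unitary Groups in Three Variables*, Ann. of Math. Stud. 123 (1990), §2.2 (p. 13) [Rogawski1990].
* A. Borel, *Introduction aux groupes arithmétiques* (1969), §12–§13 [Borel1969].
* J. Arthur, *A trace formula for reductive groups I*, Duke Math. J. 45 (1978), §8 (pp. 947–950) [Arthur1978TraceFormulaI].
-/

set_option autoImplicit false

noncomputable section

open NumberField NumberField.mixedEmbedding IsDedekindDomain Set Topology
open scoped NNReal Pointwise MatrixGroups Classical

namespace Literature.NumberTheory.Automorphic

namespace UnitaryGroup

variable {F E : Type} [Field F] [NumberField F] [Field E] [NumberField E] [Algebra F E] {c : E ≃ₐ[F] E}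

omit [NumberField F] in
/-- `archHom` is continuous. [folklore] -/
private theorem continuous_archHom₂ : Continuous (archHom E) :=
  (continuous_ringEquiv_mixedSpace E).comp continuous_fst

/-! ## §1 GLUE (ρ) at `N = 2`: the root norm on the Siegel set is `≲ H^{-2/[E:ℚ]}` -/

/-- **THE ROOT NORM DECAYS LIKE `H^{-2/[E:ℚ]}` ON THE SIEGEL SET OF `U(J₂)`.** Let `Ω ⊆ N(𝔸_F)`, `S_T` consist of torus elements with the
BALANCE `‖(d₀⁻¹ d₁)_w‖ ≤ κ · H(t)^{−2/[E:ℚ]}` of ★ `exists_torusSiegelSet_two`, and `B ∩ K_U = {k : adelicVal k ∈ K_∞ · GL₂(𝒪̂_E)}`. Then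
there is `κ' ≥ 0` with `‖(d₀⁻¹ d₁)_∞‖ ≤ κ' · H(b)^{−2/[E:ℚ]}` (sup norm on `E ⊗ ℝ`) for every `b ∈ Ω · S_T · (B ∩ K_U)` with `1 ≤ H(b)`:
with `b = n t k`, `d(b) = d(t) · d(torusPart k)` (the second factor over the compact `B ∩ K_U`), `H(b) = H(t)`.
[cite: Rogawski1990, §2.2 (p. 13)] [cite: Borel1969, §12.3] -/
theorem exists_rootNorm_le_rpow_of_balance_two {Ω ST : Set (borelAdelic F E c 2)}
    (hΩN : Ω ⊆ (unipotentInBorel F E c 2 : Set (borelAdelic F E c 2)))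
    (hSTt : ∀ t ∈ ST, torusPart t = t) {κ : ℝ}
    (hbal : ∀ t ∈ ST, ∀ w : InfinitePlace E,
      ‖((((diagUnit t.2 0)⁻¹ * diagUnit t.2 1 : (AdeleRing (𝓞 E) E)ˣ) : AdeleRing (𝓞 E) E)).1 w‖ ≤
        κ * ((borelHeight (t : (quasiSplit F E c 2).Adelic) : ℝ) ^ (-(2 / (Module.finrank ℚ E : ℝ))))) :
    ∃ κ' : ℝ, 0 ≤ κ' ∧ ∀ b ∈ Ω * ST * {k : borelAdelic F E c 2 |
        adelicVal F E c 2 ((StdForm.antidiagonal 2).over E) (k : (quasiSplit F E c 2).Adelic) ∈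
          standardMaximalCompactGL 2 E},
      1 ≤ borelHeight (b : (quasiSplit F E c 2).Adelic) →
      ‖archHom E ((((diagUnit b.2 0)⁻¹ * diagUnit b.2 1 : (AdeleRing (𝓞 E) E)ˣ)) : AdeleRing (𝓞 E) E)‖ ≤
        κ' * ((borelHeight (b : (quasiSplit F E c 2).Adelic) : ℝ) ^ (-(2 / (Module.finrank ℚ E : ℝ)))) := by
  -- `B ∩ K_U` is compact; a bound for the root norm of `torusPart k`, `k ∈ B ∩ K_U`
  set KB : Set (borelAdelic F E c 2) := {k : borelAdelic F E c 2 |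
    adelicVal F E c 2 ((StdForm.antidiagonal 2).over E) (k : (quasiSplit F E c 2).Adelic) ∈
      standardMaximalCompactGL 2 E} with hKB
  have hKBc : IsCompact KB := isCompact_setOf_adelicVal_mem
  obtain ⟨K₁, hK₁⟩ := hKBc.exists_bound_of_continuousOn
    ((continuous_archHom₂ (E := E)).comp (continuous_rootValue_two (F := F) (E := E) (c := c))).continuousOn
  set κ₀ : ℝ := max κ 0 with hκ₀
  have hκ₀0 : 0 ≤ κ₀ := le_max_right _ _
  set L₁ : ℝ := max K₁ 0 with hL₁
  have hL₁0 : 0 ≤ L₁ := le_max_right _ _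
  refine ⟨κ₀ * L₁, mul_nonneg hκ₀0 hL₁0, ?_⟩
  rintro b ⟨x, ⟨n, hn, t, ht, rfl⟩, k, hk, rfl⟩ hH
  set n' : ℝ := (Module.finrank ℚ E : ℝ) with hn'
  have hnN : ((n : borelAdelic F E c 2) : (quasiSplit F E c 2).Adelic) ∈ adelicUnipotent F E c 2 := hΩN hn
  have htt : torusPart t = t := hSTt t ht
  set tk : borelAdelic F E c 2 := torusPart k with htk
  have htkt : torusPart tk = tk := torusPart_eq_self_of_mem (torusPart_mem_torusAdelic k)
  have hTP : torusPart (n * t * k) = t * tk := torusPart_mul_mul_eq hnN htt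
  have hHt : borelHeight (((n * t * k : borelAdelic F E c 2)) : (quasiSplit F E c 2).Adelic) =
      borelHeight ((t : borelAdelic F E c 2) : (quasiSplit F E c 2).Adelic) := borelHeight_mul_mul_eq hnN hk
  rw [hHt] at hH ⊢
  set h : ℝ := ((borelHeight ((t : borelAdelic F E c 2) : (quasiSplit F E c 2).Adelic) : ℝ) ^ (-(2 / n'))) with hh
  have hHpos : (0 : ℝ) < (borelHeight ((t : borelAdelic F E c 2) : (quasiSplit F E c 2).Adelic) : ℝ) :=
    NNReal.coe_pos.2 (borelHeight_pos _)
  have hh0 : 0 < h := Real.rpow_pos_of_pos hHpos _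
  -- the root value of `b` is that of `t · tk`
  have hroot : ∀ i, diagUnit (n * t * k).2 i = diagUnit (t * tk).2 i := fun i => by
    rw [← diagUnit_torusPart (n * t * k) i, hTP]
  have e₁ : ((((diagUnit (n * t * k).2 0)⁻¹ * diagUnit (n * t * k).2 1 : (AdeleRing (𝓞 E) E)ˣ)) : AdeleRing (𝓞 E) E) =
      (((diagUnit t.2 0)⁻¹ * diagUnit t.2 1 : (AdeleRing (𝓞 E) E)ˣ) : AdeleRing (𝓞 E) E) *
        (((diagUnit tk.2 0)⁻¹ * diagUnit tk.2 1 : (AdeleRing (𝓞 E) E)ˣ) : AdeleRing (𝓞 E) E) := by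
    rw [hroot 0, hroot 1]; exact rootValue_two_mul htt htkt
  -- the `tk`-factor is bounded (`diagUnit tk = diagUnit k`, `k ∈ B ∩ K_U`)
  have htkd : ∀ i, diagUnit tk.2 i = diagUnit k.2 i := fun i => diagUnit_torusPart k i
  have b₁ : ‖archHom E ((((diagUnit tk.2 0)⁻¹ * diagUnit tk.2 1 : (AdeleRing (𝓞 E) E)ˣ)) : AdeleRing (𝓞 E) E)‖ ≤ L₁ := by
    rw [htkd 0, htkd 1]; exact (hK₁ k hk).trans (le_max_left _ _)
  -- the `t`-factor: BALANCE
  have hbal' : ∀ w : InfinitePlace E,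
      ‖((((diagUnit t.2 0)⁻¹ * diagUnit t.2 1 : (AdeleRing (𝓞 E) E)ˣ) : AdeleRing (𝓞 E) E)).1 w‖ ≤ κ₀ * h :=
    fun w => (hbal t ht w).trans (mul_le_mul_of_nonneg_right (le_max_left _ _) hh0.le)
  have a₁ : ‖archHom E ((((diagUnit t.2 0)⁻¹ * diagUnit t.2 1 : (AdeleRing (𝓞 E) E)ˣ)) : AdeleRing (𝓞 E) E)‖ ≤ κ₀ * h :=
    norm_archHom_le_of_forall (mul_nonneg hκ₀0 hh0.le) hbal'
  rw [e₁, map_mul]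
  refine (norm_mul_le _ _).trans ?_
  calc ‖archHom E ((((diagUnit t.2 0)⁻¹ * diagUnit t.2 1 : (AdeleRing (𝓞 E) E)ˣ)) : AdeleRing (𝓞 E) E)‖ *
        ‖archHom E ((((diagUnit tk.2 0)⁻¹ * diagUnit tk.2 1 : (AdeleRing (𝓞 E) E)ˣ)) : AdeleRing (𝓞 E) E)‖
      ≤ (κ₀ * h) * L₁ := mul_le_mul a₁ b₁ (norm_nonneg _) (mul_nonneg hκ₀0 hh0.le)
    _ = κ₀ * L₁ * h := by ring

/-- **The root norm in the `N = 3` exponent**: on `S` above height `1`, `‖(d₀⁻¹ d₁)_∞‖ ≤ κ' · H(b)^{−1/[E:ℚ]}` (since `H ≥ 1`,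
`H^{−2/[E:ℚ]} ≤ H^{−1/[E:ℚ]}`) — the shape ★ `exists_forall_enorm_kernel_sub_kernelBorel_le_of_oscillation`-type consumers read.
[cite: Rogawski1990, §2.2 (p. 13)] [cite: Borel1969, §12.3] -/
theorem exists_rootNorm_le_rpow_inv_of_balance_two {Ω ST : Set (borelAdelic F E c 2)}
    (hΩN : Ω ⊆ (unipotentInBorel F E c 2 : Set (borelAdelic F E c 2)))
    (hSTt : ∀ t ∈ ST, torusPart t = t) {κ : ℝ}
    (hbal : ∀ t ∈ ST, ∀ w : InfinitePlace E,
      ‖((((diagUnit t.2 0)⁻¹ * diagUnit t.2 1 : (AdeleRing (𝓞 E) E)ˣ) : AdeleRing (𝓞 E) E)).1 w‖ ≤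
        κ * ((borelHeight (t : (quasiSplit F E c 2).Adelic) : ℝ) ^ (-(2 / (Module.finrank ℚ E : ℝ))))) :
    ∃ κ' : ℝ, 0 ≤ κ' ∧ ∀ b ∈ Ω * ST * {k : borelAdelic F E c 2 |
        adelicVal F E c 2 ((StdForm.antidiagonal 2).over E) (k : (quasiSplit F E c 2).Adelic) ∈
          standardMaximalCompactGL 2 E},
      1 ≤ borelHeight (b : (quasiSplit F E c 2).Adelic) →
      ‖archHom E ((((diagUnit b.2 0)⁻¹ * diagUnit b.2 1 : (AdeleRing (𝓞 E) E)ˣ)) : AdeleRing (𝓞 E) E)‖ ≤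
        κ' * ((borelHeight (b : (quasiSplit F E c 2).Adelic) : ℝ) ^ (-(1 / (Module.finrank ℚ E : ℝ)))) := by
  obtain ⟨κ', hκ'0, hκ'⟩ := exists_rootNorm_le_rpow_of_balance_two hΩN hSTt hbal
  refine ⟨κ', hκ'0, fun b hb hH => (hκ' b hb hH).trans (mul_le_mul_of_nonneg_left ?_ hκ'0)⟩
  have h1 : (1 : ℝ) ≤ (borelHeight (b : (quasiSplit F E c 2).Adelic) : ℝ) := by exact_mod_cast hH
  refine Real.rpow_le_rpow_of_exponent_le h1 (neg_le_neg ?_)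
  exact div_le_div_of_nonneg_right (by norm_num) (Nat.cast_nonneg _)

/-! ## §2 The torus factor `S_T · K_T` of the thin set lies in «compact · ray» -/

/-- `d_i` of a product of torus elements of `U(J₂)` read on `T(𝔸_F)` and of an inverse. [cite: Rogawski1990, §1.10] -/
private theorem diagUnit_torus_inv_mul₂ (a t : torusInBorel F E c 2) (i : Fin 2) :
    diagUnit (((a⁻¹ * t : torusInBorel F E c 2) : borelAdelic F E c 2)).2 i =
      (diagUnit (a : borelAdelic F E c 2).2 i)⁻¹ * diagUnit (t : borelAdelic F E c 2).2 i := by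
  have ha : torusPart ((a : borelAdelic F E c 2)) = a := (mem_torusInBorel_iff_torusPart_eq _).1 a.2
  have hai : torusPart (((a⁻¹ : torusInBorel F E c 2) : borelAdelic F E c 2)) = ((a⁻¹ : torusInBorel F E c 2) : borelAdelic F E c 2) :=
    (mem_torusInBorel_iff_torusPart_eq _).1 (a⁻¹).2
  have ht : torusPart ((t : borelAdelic F E c 2)) = t := (mem_torusInBorel_iff_torusPart_eq _).1 t.2
  have hmul : (((a⁻¹ * t : torusInBorel F E c 2) : borelAdelic F E c 2)) =
      ((a⁻¹ : torusInBorel F E c 2) : borelAdelic F E c 2) * (t : borelAdelic F E c 2) := rfl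
  -- `d_i(a⁻¹) = d_i(a)⁻¹` from `a⁻¹ a = 1`
  have hone : diagUnit ((((a⁻¹ : torusInBorel F E c 2) : borelAdelic F E c 2)) * (a : borelAdelic F E c 2)).2 i = 1 := by
    have h1 : (((a⁻¹ : torusInBorel F E c 2) : borelAdelic F E c 2)) * (a : borelAdelic F E c 2) = 1 := by
      rw [← Subgroup.coe_mul, inv_mul_cancel, Subgroup.coe_one]
    rw [h1]
    refine Units.ext ?_
    rw [coe_diagUnit]
    change ((adelicVal F E c 2 _ (((1 : borelAdelic F E c 2)) : (quasiSplit F E c 2).Adelic)) :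
      Matrix (Fin 2) (Fin 2) (AdeleRing (𝓞 E) E)) i i = 1
    rw [Subgroup.coe_one, map_one, Units.val_one, Matrix.one_apply_eq]
  have hinv : diagUnit (((a⁻¹ : torusInBorel F E c 2) : borelAdelic F E c 2)).2 i = (diagUnit (a : borelAdelic F E c 2).2 i)⁻¹ := by
    rw [eq_inv_iff_mul_eq_one, ← diagUnit_mul_of_torusPart_eq hai ha i]
    exact hone
  rw [hmul, diagUnit_mul_of_torusPart_eq hai ht i, hinv]

/-- **THE TORUS FACTOR OF THE THIN SET LIES IN «COMPACT · RAY» (`N = 2`).** Under the polar EXPORT of ★ `exists_torusSiegelSet_two`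
(`d₀(t) = w · z(eˢ)`, `w ∈ W` compact) there are the diagonal ray `ρ` of ★ `exists_torusRay_two` (continuous, additive, height law
`H(ρ(s) t) = e^{[E:ℚ] s} H(t)`) and a compact `𝔎 ⊆ T(𝔸_F)` with `{t ∈ T(𝔸_F) | ↑t ∈ S_T · K_T} ⊆ range ρ · 𝔎`, `K_T` the torus elements of
`B ∩ K_U` — EXACTLY the `(h𝔎, hρc, hρ, hH, hS)` inputs of ★ `setLIntegral_rpow_neg_borelHeight_lt_top` (any `N`) with `κ = [E:ℚ]`
(`d₀(t₀ k) = w · z(eˢ) · d₀(k)`, so `(ρ s)⁻¹ · t₀ k` has `d₀ ∈ W · d₀(B ∩ K_U)`, a compact window: ★ `isCompact_setOf_diagUnit_zero_mem_two`).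
[cite: Borel1969, §12.3] [cite: Rogawski1990, §2.2 (p. 13)] [cite: Arthur1978TraceFormulaI, §8 (pp. 947–950)] -/
theorem exists_ray_compact_of_export_two (hc : c * c = 1) {ST : Set (borelAdelic F E c 2)}
    {W : Set (AdeleRing (𝓞 E) E)ˣ} (hW : IsCompact W) (hSTt : ∀ t ∈ ST, torusPart t = t)
    (hexp : ∀ t ∈ ST, ∃ w ∈ W, ∃ s : ℝ, diagUnit t.2 0 = w * posRealIdele E (expUnitNNReal s)) :
    ∃ (𝔎 : Set (torusInBorel F E c 2)) (ρ : ℝ → torusInBorel F E c 2),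
      IsCompact 𝔎 ∧ Continuous ρ ∧ (∀ a b, ρ (a + b) = ρ a * ρ b) ∧
      (∀ (s : ℝ) (t : torusInBorel F E c 2),
        (borelHeight (((ρ s * t : torusInBorel F E c 2) : borelAdelic F E c 2) : (quasiSplit F E c 2).Adelic) : ℝ) =
          Real.exp ((Module.finrank ℚ E : ℝ) * s) *
            borelHeight (((t : torusInBorel F E c 2) : borelAdelic F E c 2) : (quasiSplit F E c 2).Adelic)) ∧
      {t : torusInBorel F E c 2 | (t : borelAdelic F E c 2) ∈ ST * {k : borelAdelic F E c 2 |
          adelicVal F E c 2 ((StdForm.antidiagonal 2).over E) (k : (quasiSplit F E c 2).Adelic) ∈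
            standardMaximalCompactGL 2 E ∧ torusPart k = k}} ⊆ Set.range ρ * 𝔎 := by
  have hKBc : IsCompact {k : borelAdelic F E c 2 |
      adelicVal F E c 2 ((StdForm.antidiagonal 2).over E) (k : (quasiSplit F E c 2).Adelic) ∈
        standardMaximalCompactGL 2 E} := isCompact_setOf_adelicVal_mem
  obtain ⟨ρ, hρc, hρadd, hρd, hρH⟩ := exists_torusRay_two (F := F) (E := E) (c := c) hc
  have hWc : IsCompact (W * ((fun k : borelAdelic F E c 2 => diagUnit k.2 0) '' {k : borelAdelic F E c 2 |
      adelicVal F E c 2 ((StdForm.antidiagonal 2).over E) (k : (quasiSplit F E c 2).Adelic) ∈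
        standardMaximalCompactGL 2 E})) :=
    hW.mul (hKBc.image ((continuous_apply 0).comp continuous_diagUnit))
  refine ⟨{t' : torusInBorel F E c 2 | diagUnit (t' : borelAdelic F E c 2).2 0 ∈
      W * ((fun k : borelAdelic F E c 2 => diagUnit k.2 0) '' {k : borelAdelic F E c 2 |
        adelicVal F E c 2 ((StdForm.antidiagonal 2).over E) (k : (quasiSplit F E c 2).Adelic) ∈
          standardMaximalCompactGL 2 E})}, ρ,
    isCompact_setOf_diagUnit_zero_mem_two hc hWc, hρc, hρadd, hρH, ?_⟩
  rintro t ⟨t₀, ht₀, k, ⟨hk, hkt⟩, e⟩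
  obtain ⟨w, hw, s, h0⟩ := hexp t₀ ht₀
  have ht₀t : torusPart t₀ = t₀ := hSTt t₀ ht₀
  have e0 : diagUnit (t : borelAdelic F E c 2).2 0 = diagUnit t₀.2 0 * diagUnit k.2 0 := by
    rw [← e]; exact diagUnit_mul_of_torusPart_eq ht₀t hkt 0
  refine Set.mem_mul.2 ⟨ρ s, Set.mem_range_self s, (ρ s)⁻¹ * t, ?_, mul_inv_cancel_left _ _⟩
  change diagUnit ((((ρ s)⁻¹ * t : torusInBorel F E c 2) : borelAdelic F E c 2)).2 0 ∈
    W * ((fun k : borelAdelic F E c 2 => diagUnit k.2 0) '' {k : borelAdelic F E c 2 |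
      adelicVal F E c 2 ((StdForm.antidiagonal 2).over E) (k : (quasiSplit F E c 2).Adelic) ∈
        standardMaximalCompactGL 2 E})
  rw [diagUnit_torus_inv_mul₂, hρd s, e0, h0, mul_comm w, mul_assoc, inv_mul_cancel_left]
  exact Set.mul_mem_mul hw ⟨k, hk, rfl⟩

end UnitaryGroup

end Literature.NumberTheory.Automorphic

end
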